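import Mathlib
import Literature.Analysis.FluidPDE.ClassicalSolution
import Literature.Analysis.FluidPDE.RapidDecayLemmas
import Literature.Analysis.FluidPDE.VorticityEquation
import Literature.Analysis.FluidPDE.ClassicalSolutionProofs
import Literature.Analysis.FluidPDE.BoundedDecayIBP
import HarnessLib

/-!
# The adjoint pairing identity (Helmholtz duality) for classical window solutions

Stub `stub_clockAdjointPairing` (K1 of the card `flux-weighted-stretching-clock`) of the line
`Sketch` for the crux `Theses.RecurrentProfiles.RecurrentLiouville`
(stmt-NavierStokesRegularity-1589).

Let `(u, q)` be a classical solution of the unforced Navier–Stokes system (`ν = 1`) on the window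
`S = [t₀, t₁]`, `t₀ < t₁`, with `u` and its spatial derivatives of orders `≤ 3` bounded on
`S × ℝ³`, and let `η` be an ADJOINT TEST FIELD on the window: jointly smooth, uniformly rapidly
decaying (`HasUniformRapidDecayOn S η`) and solving the backward equation
`∂ₜη + Δη + (u·∇)η + (∇u)ᵀη = 0`.  Then the pairing `Φ(s) = ∫ ⟪ω(s, x), η(s, x)⟫ dx` of the
vorticity `ω = curl u` with `η` does not depend on `s ∈ S` (`stub_clockAdjointPairing`).

## Proof

1. The vorticity solves `∂ₜω + (u·∇)ω = (∇u)ω + Δω` on `S × ℝ³` (the tree's vorticity equation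
   of a classical solution, `IsClassicalNSSolutionOn.isVorticitySolutionOn_zero_force`, available
   since `[t₀, t₁]` has unique differentiability and lies in the closure of its interior); by the
   `C³` bounds on `u`, the fields `ω`, `Dω`, `D²ω`, `Δω` and hence `∂ₜω` are bounded on
   `S × ℝ³`, while `η`, `Dη`, `D²η`, `∂ₜη` decay like `(1 + ‖x‖)^{-4}` uniformly in time
   (`RapidDecayLemmas`).
2. Hence `Φ` is differentiable WITHIN `S` at every `t ∈ S` with
   `Φ'(t) = ∫ (⟪ω, ∂ₜη⟫ + ⟪∂ₜω, η⟫)` (one-sided differentiation under the integral sign,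
   `hasDerivWithinAt_integral_of_dominated_convex`, dominated by `K (1 + ‖x‖)^{-4}`).
3. At a fixed time, inserting both equations, the integrand is
   `(⟪Δω, η⟫ − ⟪ω, Δη⟫) − (⟪Dω(u), η⟫ + ⟪ω, Dη(u)⟫) + (⟪(∇u)ω, η⟫ − ⟪ω, (∇u)ᵀη⟫)`; the last
   bracket vanishes pointwise (`ContinuousLinearMap.adjoint_inner_right`), the first integrates to
   zero by Green's second identity and the second by `div u = 0` — both in the "bounded × decaying"
   form of `Literature.Analysis.FluidPDE.BoundedDecayIBP`
   (`integral_inner_laplacian_comm_of_bdd_of_decay`,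
   `integral_inner_fderiv_apply_add_eq_zero_of_bdd_of_decay`).  This is `clockAP_slice_identity`.
4. A function with zero derivative within the convex set `S` is constant on `S`
   (`Convex.norm_image_sub_le_of_norm_hasDerivWithin_le`).

References: A. J. Majda, A. L. Bertozzi, *Vorticity and Incompressible Flow*, CUP 2002, §1.6
Prop. 1.8 (Helmholtz / vorticity transport) and §2.4 (2.110) (the viscous vorticity equation);
the templates are the tree's helicity and energy identities (`NSVorticityHelicityProofs`,
`ClassicalSolutionProofs`).
-/

noncomputable section

set_option linter.dupNamespace false

namespace Summit.NavierStokesRegularity.NavierStokesRegularity.Theorems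

open MeasureTheory Set Function Filter Topology TopologicalSpace Metric
open Literature.Analysis Literature.Analysis.FluidPDE
open scoped NNReal ENNReal RealInnerProductSpace Laplacian

/-! ### Derivatives of the curl -/

/-- `‖D²(curl v)(x)‖ ≤ κ ‖D³v(x)‖` for `v ∈ C³`, `κ = ‖curlCLM‖` (`curl v = curlCLM ∘ Dv`, Mathlib
`ContinuousLinearMap.norm_iteratedFDeriv_comp_left`). -/
theorem clockAP_norm_fderiv_fderiv_curl_le
    {v : EuclideanSpace ℝ (Fin 3) → EuclideanSpace ℝ (Fin 3)} (hv : ContDiff ℝ 3 v)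
    (x : EuclideanSpace ℝ (Fin 3)) :
    ‖fderiv ℝ (fderiv ℝ (curl v)) x‖ ≤ ‖curlCLM‖ * ‖iteratedFDeriv ℝ 3 v x‖ := by
  have hDv : ContDiff ℝ 2 (fderiv ℝ v) := hv.fderiv_right (m := 2) (by norm_num)
  have h := curlCLM.norm_iteratedFDeriv_comp_left (x := x) (n := 2) hDv.contDiffAt
    (mod_cast le_rfl)
  rw [norm_iteratedFDeriv_fderiv, ← curl_eq_curlCLM_comp] at h
  have h2 : ‖fderiv ℝ (fderiv ℝ (curl v)) x‖ = ‖iteratedFDeriv ℝ 2 (curl v) x‖ := by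
    rw [← norm_iteratedFDeriv_fderiv, norm_iteratedFDeriv_one]
  rw [h2]
  exact h

/-- `‖Δ(curl v)(x)‖ ≤ 3κ ‖D³v(x)‖` for `v ∈ C³` (`‖Δf‖ ≤ dim · ‖D²f‖`, `norm_laplacian_le`). -/
theorem clockAP_norm_laplacian_curl_le
    {v : EuclideanSpace ℝ (Fin 3) → EuclideanSpace ℝ (Fin 3)} (hv : ContDiff ℝ 3 v)
    (x : EuclideanSpace ℝ (Fin 3)) :
    ‖(Δ (curl v)) x‖ ≤ 3 * (‖curlCLM‖ * ‖iteratedFDeriv ℝ 3 v x‖) := by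
  have h1 := norm_laplacian_le (curl v) x
  rw [finrank_euclideanSpace_fin] at h1
  push_cast at h1
  exact h1.trans (mul_le_mul_of_nonneg_left (clockAP_norm_fderiv_fderiv_curl_le hv x) (by norm_num))

/-! ### The fixed-time identity -/

/-- **The fixed-time cancellation behind the adjoint pairing identity.**  Let `U ∈ C³(ℝ³; ℝ³)` be
divergence free with `U`, `DU`, `D²U`, `D³U` bounded by `B`, let `φ ∈ C²` with `φ`, `Dφ`, `D²φ`
bounded by `C (1 + ‖x‖)^{-r}`, `3 < r`, and let `W`, `Z` be the two "time derivatives":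
`W + (U·∇)ω = (ω·∇)U + Δω` (`ω = curl U`, the vorticity equation at a fixed time) and
`Z + Δφ + (U·∇)φ + (∇U)ᵀφ = 0` (the adjoint equation at a fixed time).  Then
`∫ (⟪ω, Z⟫ + ⟪W, φ⟫) = 0`: the stretching terms cancel pointwise by the definition of the adjoint,
the Laplacian terms by Green's second identity (`integral_inner_laplacian_comm_of_bdd_of_decay`)
and the transport terms by incompressibility
(`integral_inner_fderiv_apply_add_eq_zero_of_bdd_of_decay`). -/
theorem clockAP_slice_identity
    {U φ W Z : EuclideanSpace ℝ (Fin 3) → EuclideanSpace ℝ (Fin 3)}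
    (hU : ContDiff ℝ 3 U) (hφ : ContDiff ℝ 2 φ) (hdiv : VectorCalculus.IsDivFree U)
    (hW : ∀ x, W x + convect U (curl U) x = convect (curl U) U x + (1 : ℝ) • (Δ (curl U)) x)
    (hZ : ∀ x, Z x + (Δ φ) x + convect U φ x
      + ContinuousLinearMap.adjoint (fderiv ℝ U x) (φ x) = 0)
    {B C r : ℝ} (hr : (3 : ℝ) < r)
    (hU0 : ∀ x, ‖U x‖ ≤ B) (hU1 : ∀ x, ‖fderiv ℝ U x‖ ≤ B)
    (hU2 : ∀ x, ‖iteratedFDeriv ℝ 2 U x‖ ≤ B) (hU3 : ∀ x, ‖iteratedFDeriv ℝ 3 U x‖ ≤ B)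
    (hφ0 : ∀ x, ‖φ x‖ ≤ C * (1 + ‖x‖) ^ (-r)) (hφ1 : ∀ x, ‖fderiv ℝ φ x‖ ≤ C * (1 + ‖x‖) ^ (-r))
    (hφ2 : ∀ x, ‖fderiv ℝ (fderiv ℝ φ) x‖ ≤ C * (1 + ‖x‖) ^ (-r)) :
    ∫ x, (⟪curl U x, Z x⟫ + ⟪W x, φ x⟫) = 0 := by
  have hr3 : (Module.finrank ℝ (EuclideanSpace ℝ (Fin 3)) : ℝ) < r := by
    rw [finrank_euclideanSpace_fin]; exact_mod_cast hr
  have hB : 0 ≤ B := (norm_nonneg _).trans (hU0 0)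
  have hCw : ∀ x : EuclideanSpace ℝ (Fin 3), 0 ≤ C * (1 + ‖x‖) ^ (-r) := fun x =>
    (norm_nonneg _).trans (hφ0 x)
  have hU1' : ContDiff ℝ 1 U := hU.of_le (by norm_num)
  have hU2' : ContDiff ℝ 2 U := hU.of_le (by norm_num)
  have hω2 : ContDiff ℝ 2 (curl U) := contDiff_curl (n := 2) (by exact_mod_cast hU)
  have hω1 : ContDiff ℝ 1 (curl U) := hω2.of_le one_le_two
  -- bounds on the vorticity and its derivatives
  have hω0 : ∀ x, ‖curl U x‖ ≤ ‖curlCLM‖ * B := fun x =>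
    (norm_curl_le U x).trans (mul_le_mul_of_nonneg_left (hU1 x) (norm_nonneg curlCLM))
  have hωD : ∀ x, ‖fderiv ℝ (curl U) x‖ ≤ ‖curlCLM‖ * B := fun x =>
    (norm_fderiv_curl_le hU2' x).trans (mul_le_mul_of_nonneg_left (hU2 x) (norm_nonneg curlCLM))
  have hωD2 : ∀ x, ‖fderiv ℝ (fderiv ℝ (curl U)) x‖ ≤ ‖curlCLM‖ * B := fun x =>
    (clockAP_norm_fderiv_fderiv_curl_le hU x).trans
      (mul_le_mul_of_nonneg_left (hU3 x) (norm_nonneg curlCLM))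
  have hωΔ : ∀ x, ‖(Δ (curl U)) x‖ ≤ 3 * (‖curlCLM‖ * B) := fun x =>
    (clockAP_norm_laplacian_curl_le hU x).trans (by gcongr; exact hU3 x)
  have hφΔ : ∀ x, ‖(Δ φ) x‖ ≤ 3 * C * (1 + ‖x‖) ^ (-r) := fun x => by
    have h1 := norm_laplacian_le φ x
    rw [finrank_euclideanSpace_fin] at h1
    push_cast at h1
    calc ‖(Δ φ) x‖ ≤ 3 * ‖fderiv ℝ (fderiv ℝ φ) x‖ := h1
      _ ≤ 3 * (C * (1 + ‖x‖) ^ (-r)) := by gcongr; exact hφ2 x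
      _ = 3 * C * (1 + ‖x‖) ^ (-r) := by ring
  -- Green's second identity and the transport identity (bounded × decaying)
  have hMB : ∀ x, ‖U x‖ ≤ B + ‖curlCLM‖ * B := fun x =>
    (hU0 x).trans (le_add_of_nonneg_right (by positivity))
  have hMω : ∀ x, ‖curl U x‖ ≤ B + ‖curlCLM‖ * B := fun x =>
    (hω0 x).trans (le_add_of_nonneg_left hB)
  have hMωD : ∀ x, ‖fderiv ℝ (curl U) x‖ ≤ B + ‖curlCLM‖ * B := fun x =>
    (hωD x).trans (le_add_of_nonneg_left hB)
  have hG : ∫ x, ⟪(Δ (curl U)) x, φ x⟫ = ∫ x, ⟪curl U x, (Δ φ) x⟫ :=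
    integral_inner_laplacian_comm_of_bdd_of_decay hω2 hφ hr3 hω0 hωD hωD2 hφ0 hφ1 hφ2
  have hT : ∫ x, (⟪fderiv ℝ (curl U) x (U x), φ x⟫ + ⟪curl U x, fderiv ℝ φ x (U x)⟫) = 0 :=
    integral_inner_fderiv_apply_add_eq_zero_of_bdd_of_decay hU1' hω1 (hφ.of_le one_le_two) hdiv hr3
      hMB hMω hMωD hφ0 hφ1
  -- pointwise form of the integrand
  have hpt : ∀ x, ⟪curl U x, Z x⟫ + ⟪W x, φ x⟫ =
      (⟪(Δ (curl U)) x, φ x⟫ - ⟪curl U x, (Δ φ) x⟫) -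
        (⟪fderiv ℝ (curl U) x (U x), φ x⟫ + ⟪curl U x, fderiv ℝ φ x (U x)⟫) := by
    intro x
    have hZ' : Z x = -((Δ φ) x + convect U φ x
        + ContinuousLinearMap.adjoint (fderiv ℝ U x) (φ x)) := by
      have h := hZ x
      rw [← sub_eq_zero, sub_neg_eq_add]
      simpa only [add_assoc] using h
    have hW' : W x = convect (curl U) U x + (1 : ℝ) • (Δ (curl U)) x - convect U (curl U) x :=
      eq_sub_of_add_eq (hW x)
    rw [hZ', hW']
    simp only [inner_neg_right, inner_add_right, inner_add_left, inner_sub_left, one_smul,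
      convect_apply, ContinuousLinearMap.adjoint_inner_right]
    ring
  -- integrability of the four pairings
  have iG1 : Integrable (fun x => ⟪(Δ (curl U)) x, φ x⟫)
      (volume : Measure (EuclideanSpace ℝ (Fin 3))) :=
    integrable_inner_of_bdd_of_decay (continuous_laplacian hω2) hφ.continuous hr3 hωΔ hφ0
  have iG2 : Integrable (fun x => ⟪curl U x, (Δ φ) x⟫)
      (volume : Measure (EuclideanSpace ℝ (Fin 3))) :=
    integrable_inner_of_bdd_of_decay (continuous_curl hU1') (continuous_laplacian hφ) hr3 hω0 hφΔ
  have iT1 : Integrable (fun x => ⟪fderiv ℝ (curl U) x (U x), φ x⟫)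
      (volume : Measure (EuclideanSpace ℝ (Fin 3))) :=
    integrable_inner_of_bdd_of_decay ((hω1.continuous_fderiv one_ne_zero).clm_apply hU.continuous)
      hφ.continuous hr3 (M := ‖curlCLM‖ * B * B)
      (fun x => (ContinuousLinearMap.le_opNorm _ _).trans
        (mul_le_mul (hωD x) (hU0 x) (norm_nonneg _) (by positivity))) hφ0
  have iT2 : Integrable (fun x => ⟪curl U x, fderiv ℝ φ x (U x)⟫)
      (volume : Measure (EuclideanSpace ℝ (Fin 3))) := by
    refine integrable_inner_of_bdd_of_decay (continuous_curl hU1')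
      ((hφ.continuous_fderiv two_ne_zero).clm_apply hU.continuous) hr3 (C := C * B) hω0 fun x => ?_
    calc ‖fderiv ℝ φ x (U x)‖ ≤ ‖fderiv ℝ φ x‖ * ‖U x‖ := ContinuousLinearMap.le_opNorm _ _
      _ ≤ C * (1 + ‖x‖) ^ (-r) * B := mul_le_mul (hφ1 x) (hU0 x) (norm_nonneg _) (hCw x)
      _ = C * B * (1 + ‖x‖) ^ (-r) := by ring
  have iG : Integrable (fun x => ⟪(Δ (curl U)) x, φ x⟫ - ⟪curl U x, (Δ φ) x⟫)
      (volume : Measure (EuclideanSpace ℝ (Fin 3))) := iG1.sub iG2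
  have iT : Integrable (fun x => ⟪fderiv ℝ (curl U) x (U x), φ x⟫ + ⟪curl U x, fderiv ℝ φ x (U x)⟫)
      (volume : Measure (EuclideanSpace ℝ (Fin 3))) := iT1.add iT2
  simp_rw [hpt]
  rw [integral_sub iG iT, integral_sub iG1 iG2, hG, hT, sub_self, sub_zero]

/-! ### The registered stub -/

/-- **Adjoint pairing identity** (registered stub of the line `Sketch`; Helmholtz's theorem in
dual form).  On a window `S = [t₀, t₁]`, `t₀ < t₁`, let `(u, q)` be a classical solution of the
unforced Navier–Stokes system with `ν = 1` whose velocity and spatial derivatives of orders `≤ 3`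
are bounded on `S × ℝ³`, and let `η` be an adjoint test field of `u` on the window — jointly smooth,
uniformly rapidly decaying, with `∂ₜη + Δη + (u·∇)η + (∇u)ᵀη = 0`.  Then the pairing
`∫ ⟪curl u(s), η(s)⟫` does not depend on `s ∈ S`.  Proof: the pairing is differentiable within
`S` with derivative `∫ (⟪ω, ∂ₜη⟫ + ⟪∂ₜω, η⟫)` (differentiation under the integral sign, dominated
through the bounds on `ω`, `∂ₜω` — the latter from the vorticity equation — and the uniform decay
of `η`, `∂ₜη`), the derivative vanishes by `clockAP_slice_identity`, and a function with zero
derivative within a convex set is constant. -/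
theorem stub_clockAdjointPairing :
    ∀ (t₀ t₁ : ℝ), t₀ < t₁ →
      ∀ (u : ℝ → EuclideanSpace ℝ (Fin 3) → EuclideanSpace ℝ (Fin 3))
        (q : ℝ → EuclideanSpace ℝ (Fin 3) → ℝ)
        (η : ℝ → EuclideanSpace ℝ (Fin 3) → EuclideanSpace ℝ (Fin 3)),
      IsClassicalNSSolutionOn (Set.Icc t₀ t₁) 1 0 u q →
      (∃ B : ℝ, ∀ t ∈ Set.Icc t₀ t₁, ∀ x : EuclideanSpace ℝ (Fin 3),
        ‖u t x‖ ≤ B ∧ ‖fderiv ℝ (u t) x‖ ≤ B ∧ ‖iteratedFDeriv ℝ 2 (u t) x‖ ≤ B ∧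
          ‖iteratedFDeriv ℝ 3 (u t) x‖ ≤ B) →
      IsSmoothSpaceTimeOn (Set.Icc t₀ t₁) η →
      HasUniformRapidDecayOn (Set.Icc t₀ t₁) η →
      (∀ t ∈ Set.Icc t₀ t₁, ∀ x : EuclideanSpace ℝ (Fin 3),
        timeDerivWithin (Set.Icc t₀ t₁) η t x + (Δ (η t)) x + convect (u t) (η t) x
          + ContinuousLinearMap.adjoint (fderiv ℝ (u t) x) (η t x) = 0) →
      ∀ s ∈ Set.Icc t₀ t₁,
        ∫ x, ⟪curl (u s) x, η s x⟫ = ∫ x, ⟪curl (u t₁) x, η t₁ x⟫ := by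
  intro t₀ t₁ h01 u q η hns hBex hη hηd hadj s hs
  obtain ⟨B, hB⟩ := hBex
  -- the window
  have hU : UniqueDiffOn ℝ (Icc t₀ t₁) := uniqueDiffOn_Icc h01
  have hcl : Icc t₀ t₁ ⊆ closure (interior (Icc t₀ t₁)) := by
    rw [interior_Icc, closure_Ioo h01.ne]
  have hconv : Convex ℝ (Icc t₀ t₁) := convex_Icc t₀ t₁
  have ht₁ : t₁ ∈ Icc t₀ t₁ := right_mem_Icc.2 h01.le
  have hsm : IsSmoothSpaceTimeOn (Icc t₀ t₁) u := hns.smooth_velocity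
  have hvort : IsVorticitySolutionOn (Icc t₀ t₁) 1 u := hns.isVorticitySolutionOn_zero_force hU hcl
  have hB0 : 0 ≤ B := (norm_nonneg _).trans (hB t₁ ht₁ 0).1
  -- regularity of the slices
  have hv3 : ∀ t ∈ Icc t₀ t₁, ContDiff ℝ 3 (u t) := fun t ht =>
    contDiff_infty.1 (hns.contDiff_velocity ht) 3
  have hv1 : ∀ t ∈ Icc t₀ t₁, ContDiff ℝ 1 (u t) := fun t ht =>
    contDiff_infty.1 (hns.contDiff_velocity ht) 1
  have hη2 : ∀ t ∈ Icc t₀ t₁, ContDiff ℝ 2 (η t) := fun t ht =>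
    contDiff_infty.1 (hη.contDiff_slice ht) 2
  have hωst : IsSmoothSpaceTimeOn (Icc t₀ t₁) (vorticity u) :=
    (hsm.fderiv_slice hU).clm_comp curlCLM
  -- uniform decay of the test field (exponent `4 > 3 = dim`)
  have hr : (3 : ℝ) < ((4 : ℕ) : ℝ) := by norm_num
  have hr3 : (Module.finrank ℝ (EuclideanSpace ℝ (Fin 3)) : ℝ) < ((4 : ℕ) : ℝ) := by
    rw [finrank_euclideanSpace_fin]; norm_num
  obtain ⟨A0, hA0, hA0b⟩ := hηd.norm_le_rpow 4
  obtain ⟨A1, hA1, hA1b⟩ := hηd.norm_fderiv_le_rpow hη hU 4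
  obtain ⟨A2, hA2, hA2b⟩ := hηd.norm_fderiv_fderiv_le_rpow hη hU 4
  obtain ⟨A3, hA3, hA3b⟩ := hηd.norm_timeDerivWithin_le_rpow hη hU 4
  set C : ℝ := A0 + A1 + A2 + A3 with hC_def
  have h0 : ∀ t ∈ Icc t₀ t₁, ∀ x, ‖η t x‖ ≤ C * (1 + ‖x‖) ^ (-((4 : ℕ) : ℝ)) := fun t ht x =>
    le_decay_of_le_decay x (hA0b t ht x) (by rw [hC_def]; linarith)
  have h1 : ∀ t ∈ Icc t₀ t₁, ∀ x, ‖fderiv ℝ (η t) x‖ ≤ C * (1 + ‖x‖) ^ (-((4 : ℕ) : ℝ)) :=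
    fun t ht x => le_decay_of_le_decay x (hA1b t ht x) (by rw [hC_def]; linarith)
  have h2 : ∀ t ∈ Icc t₀ t₁, ∀ x,
      ‖fderiv ℝ (fderiv ℝ (η t)) x‖ ≤ C * (1 + ‖x‖) ^ (-((4 : ℕ) : ℝ)) :=
    fun t ht x => le_decay_of_le_decay x (hA2b t ht x) (by rw [hC_def]; linarith)
  have h3 : ∀ t ∈ Icc t₀ t₁, ∀ x,
      ‖timeDerivWithin (Icc t₀ t₁) η t x‖ ≤ C * (1 + ‖x‖) ^ (-((4 : ℕ) : ℝ)) :=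
    fun t ht x => le_decay_of_le_decay x (hA3b t ht x) (by rw [hC_def]; linarith)
  -- uniform bounds on the vorticity and, through the vorticity equation, on its time derivative
  have hω0 : ∀ t ∈ Icc t₀ t₁, ∀ x, ‖curl (u t) x‖ ≤ ‖curlCLM‖ * B := fun t ht x =>
    (norm_curl_le _ x).trans (mul_le_mul_of_nonneg_left (hB t ht x).2.1 (norm_nonneg curlCLM))
  have hωD : ∀ t ∈ Icc t₀ t₁, ∀ x, ‖fderiv ℝ (curl (u t)) x‖ ≤ ‖curlCLM‖ * B := fun t ht x =>
    (norm_fderiv_curl_le ((hv3 t ht).of_le (by norm_num)) x).trans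
      (mul_le_mul_of_nonneg_left (hB t ht x).2.2.1 (norm_nonneg curlCLM))
  have hωΔ : ∀ t ∈ Icc t₀ t₁, ∀ x, ‖(Δ (curl (u t))) x‖ ≤ 3 * (‖curlCLM‖ * B) := fun t ht x =>
    (clockAP_norm_laplacian_curl_le (hv3 t ht) x).trans (by gcongr; exact (hB t ht x).2.2.2)
  obtain ⟨Mt, hωt⟩ : ∃ Mt : ℝ,
      ∀ t ∈ Icc t₀ t₁, ∀ x, ‖timeDerivWithin (Icc t₀ t₁) (vorticity u) t x‖ ≤ Mt := by
    refine ⟨B * (‖curlCLM‖ * B) + 3 * (‖curlCLM‖ * B) + ‖curlCLM‖ * B * B, fun t ht x => ?_⟩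
    have heq : timeDerivWithin (Icc t₀ t₁) (vorticity u) t x =
        convect (vorticity u t) (u t) x + (1 : ℝ) • (Δ (vorticity u t)) x
          - convect (u t) (vorticity u t) x :=
      eq_sub_of_add_eq (hvort.vorticity_eq t ht x)
    rw [heq, vorticity_apply, convect_apply, convect_apply, one_smul]
    refine norm_sub_le_of_le (norm_add_le_of_le ?_ (hωΔ t ht x)) ?_
    · exact (ContinuousLinearMap.le_opNorm _ _).trans
        (mul_le_mul (hB t ht x).2.1 (hω0 t ht x) (norm_nonneg _) hB0)
    · exact (ContinuousLinearMap.le_opNorm _ _).trans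
        (mul_le_mul (hωD t ht x) (hB t ht x).1 (norm_nonneg _) (by positivity))
  -- continuity of the slices
  have hωc : ∀ t ∈ Icc t₀ t₁, Continuous (curl (u t)) := fun t ht => continuous_curl (hv1 t ht)
  have hηc : ∀ t ∈ Icc t₀ t₁, Continuous (η t) := fun t ht => hη.continuous_slice ht
  -- the dominating function
  have hpair : ∀ (x a b : EuclideanSpace ℝ (Fin 3)) (Ma : ℝ), ‖a‖ ≤ Ma →
      ‖b‖ ≤ C * (1 + ‖x‖) ^ (-((4 : ℕ) : ℝ)) →
      ‖⟪a, b⟫‖ ≤ Ma * C * (1 + ‖x‖) ^ (-((4 : ℕ) : ℝ)) := by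
    intro x a b Ma ha hb
    calc ‖⟪a, b⟫‖ ≤ ‖a‖ * ‖b‖ := norm_inner_le_norm _ _
      _ ≤ Ma * (C * (1 + ‖x‖) ^ (-((4 : ℕ) : ℝ))) :=
          mul_le_mul ha hb (norm_nonneg _) ((norm_nonneg _).trans ha)
      _ = Ma * C * (1 + ‖x‖) ^ (-((4 : ℕ) : ℝ)) := by ring
  set bound : EuclideanSpace ℝ (Fin 3) → ℝ := fun x =>
    (‖curlCLM‖ * B + Mt) * C * (1 + ‖x‖) ^ (-((4 : ℕ) : ℝ)) with hbound_def
  have hbound : Integrable bound (volume : Measure (EuclideanSpace ℝ (Fin 3))) := by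
    have := (integrable_one_add_norm (E := EuclideanSpace ℝ (Fin 3)) (μ := volume)
      hr3).const_mul ((‖curlCLM‖ * B + Mt) * C)
    simpa [hbound_def] using this
  have hF'le : ∀ t ∈ Icc t₀ t₁, ∀ x,
      ‖⟪curl (u t) x, timeDerivWithin (Icc t₀ t₁) η t x⟫
        + ⟪timeDerivWithin (Icc t₀ t₁) (vorticity u) t x, η t x⟫‖ ≤ bound x := by
    intro t ht x
    refine (norm_add_le _ _).trans ?_
    have e : bound x = ‖curlCLM‖ * B * C * (1 + ‖x‖) ^ (-((4 : ℕ) : ℝ))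
        + Mt * C * (1 + ‖x‖) ^ (-((4 : ℕ) : ℝ)) := by
      simp only [hbound_def]; ring
    rw [e]
    exact add_le_add (hpair x _ _ _ (hω0 t ht x) (h3 t ht x))
      (hpair x _ _ _ (hωt t ht x) (h0 t ht x))
  have hFi : ∀ t ∈ Icc t₀ t₁, Integrable (fun x => ⟪curl (u t) x, η t x⟫)
      (volume : Measure (EuclideanSpace ℝ (Fin 3))) := fun t ht =>
    integrable_of_norm_le_rpow_neg ((hωc t ht).inner (hηc t ht)) (C := ‖curlCLM‖ * B * C) hr3
      fun x => hpair x _ _ _ (hω0 t ht x) (h0 t ht x)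
  -- differentiation under the integral sign within the window
  have hD : ∀ t ∈ Icc t₀ t₁, HasDerivWithinAt (fun s => ∫ x, ⟪curl (u s) x, η s x⟫)
      (∫ x, (⟪curl (u t) x, timeDerivWithin (Icc t₀ t₁) η t x⟫
        + ⟪timeDerivWithin (Icc t₀ t₁) (vorticity u) t x, η t x⟫)) (Icc t₀ t₁) t := by
    intro t ht
    refine hasDerivWithinAt_integral_of_dominated_convex hconv ht
      (F := fun s x => ⟪curl (u s) x, η s x⟫)
      (F' := fun s x => ⟪curl (u s) x, timeDerivWithin (Icc t₀ t₁) η s x⟫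
        + ⟪timeDerivWithin (Icc t₀ t₁) (vorticity u) s x, η s x⟫) (bound := bound) ?_ (hFi t ht)
      hF'le hbound ?_
    · exact fun s' hs' => ((hωc s' hs').inner (hηc s' hs')).aestronglyMeasurable
    · intro s' hs' x
      exact (hωst.hasDerivWithinAt_timeDerivWithin hU hs' x).inner ℝ
        (hη.hasDerivWithinAt_timeDerivWithin hU hs' x)
  -- the derivative vanishes (fixed-time identity)
  have hzero : ∀ t ∈ Icc t₀ t₁,
      ∫ x, (⟪curl (u t) x, timeDerivWithin (Icc t₀ t₁) η t x⟫
        + ⟪timeDerivWithin (Icc t₀ t₁) (vorticity u) t x, η t x⟫) = 0 := fun t ht =>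
    clockAP_slice_identity (hv3 t ht) (hη2 t ht) (hns.divFree t ht)
      (fun x => hvort.vorticity_eq t ht x) (hadj t ht) hr
      (fun x => (hB t ht x).1) (fun x => (hB t ht x).2.1) (fun x => (hB t ht x).2.2.1)
      (fun x => (hB t ht x).2.2.2) (h0 t ht) (h1 t ht) (h2 t ht)
  have hD0 : ∀ t ∈ Icc t₀ t₁, HasDerivWithinAt (fun s => ∫ x, ⟪curl (u s) x, η s x⟫)
      ((fun _ : ℝ => (0 : ℝ)) t) (Icc t₀ t₁) t := fun t ht => by
    have h := hD t ht
    rwa [hzero t ht] at h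
  have hb : ∀ t ∈ Icc t₀ t₁, ‖(fun _ : ℝ => (0 : ℝ)) t‖ ≤ 0 := fun t _ => by simp
  have key := hconv.norm_image_sub_le_of_norm_hasDerivWithin_le hD0 hb hs ht₁
  rw [zero_mul, norm_le_zero_iff, sub_eq_zero] at key
  exact key.symm

end Summit.NavierStokesRegularity.NavierStokesRegularity.Theorems
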